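import Literature.NumberTheory.EllipticCurves.Kim2025.StructureClauseOPEN
import Literature.NumberTheory.EllipticCurves.LeadingTermPPartProofs
import HarnessLib

/-!
# ONE PRIMARY per printed statement (n1011 lead R3-18 (c)): the own-currency Kim 2025 `Prop`s of
# record and the FORMAL derivations of the other own-currency shapes from them
# (cell `b2b-bsdres`, team n1011, seat p09, OWNERS row T-a4; sequel of
# `Additive/X4KimLargeImageIntegralPeriod.lean`)

HONEST FRAMING (cell `b2b-bsdres`, run/shared/lean/b2b/bsd-rank1-residual/, verbatim in every
file): the goal of the cell is to DELETE the COMBINATION-SHAPED residual classes of the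
Birch–Swinnerton-Dyer formula for ALL analytic-rank `≤ 1` elliptic curves over `ℚ` — "full BSD
formula for every rank `≤ 1` curve in class `C`" assembled STRICTLY from published theorems — so
that the rank-`≤ 1` remainder becomes exactly the CONSTRUCTION-SHAPED classes, which are TYPED
(missing-input `Prop`s), NOT attempted. This is not "finishing BSD". Team n1011 is a RESEARCH ROUTE;
no claim beyond the stated classes; no label or mark is changed by this file; nothing is booked. An
ANNOUNCED preprint enters ONLY as an explicitly labelled OPEN hypothesis: every theorem below carrying
`hK25s : Kim2025.thm11_kimShaLength_of_integralPeriod_OPEN` is CONDITIONAL on the unrefereed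
arXiv:2505.09121v1. Theorems only (no definition, no named fact minted here). FLAG `Kim2025-preprint`
(referee-1 ACK-1 T-a4, proviso 3) on EVERY theorem below taking a `Kim2025.…_OPEN` binder.

## The designation (lead R3-18 (c), referee A's independent-count rule)

The Kim 2025 family in `Literature/NumberTheory/EllipticCurves/Kim2025/` has SIX `_OPEN` `Prop`s of ONE
preprint. PRIMARY, one per printed statement:
* **P1** = `Kim2025.thm11_kimShaLength_of_integralPeriod_OPEN` — Thm. 1.1 ("BSD"), second clause,
  every analytic rank, own currency (integral period `Ω⁺_f`, cyclic `∂`-vocabulary);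
* **P2** = `Kim2025.cor17_rankZero_padicValNat_sha_le_of_integralPeriod_OPEN` — Cor. 1.7 in analytic
  rank `0` with an ARBITRARY integral period `p^v·Ω⁺_f` (§1.4.4 "non-minimal integral periods").
DERIVED, formally, in this file from P1: (D1) P2's instance `v = 0` (`cor17_le_at_integral_of_thm11`);
(D2) the unit own-currency `Prop` `Kim2025.cor17_rankZero_padicValRat_sha_eq_of_kuriharaNumber_ne_zero_of_integralPeriod_OPEN`
ITSELF (`cor17_unit_OPEN_of_thm11_OPEN` — so it is not an independent input); (D3) the rank-one
own-currency clause (`rankOne_sha_val_eq_zero_of_thm11`: `L(E,1) = 0`, a unit at a PRIME cyclic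
Kolyvagin level ⟹ `ord_p #Ш(E/ℚ)(p) = 0`). NOT formal, hence kept as separately FLAGGED
weaker-than-print `Prop`s (flag `Kim2025-OmegaE-integrality`, recorded in the Literature file): the
three `Ω(W)`/Manin-datum shapes `rankZero_padicValNat_sha_le_of_towerSurj_OPEN`,
`rankZero_padicValRat_sha_of_kuriharaNumber_ne_zero_of_towerSurj_OPEN`,
`rankOne_card_sha_eq_one_of_kuriharaNumber_ne_zero_of_towerSurj_OPEN` — their CONCLUSIONS follow from
P1/P2 under the explicit binders [period transfer `Ω(W) = u·Ω⁺_f`, `|u|_p = 1`] ∧ [`Ω⁺_f`-integrality]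
(`X4KimLargeImageIntegralPeriod.lean` §1–§2), but the defs carry `p ∤ c_D` in place of those two, and
"`p ∤ c_D` ∧ large image ⟹ `Ω(W)` is an integral period" is the integrality INPUT (Kim AJM 148
§1.4.1; Wuthrich, Doc. Math. 19 (2014) Thm. 4: Néron-lattice integrality FAILS at additive primes in
general — 27a, 54a at `3`, reducible — so the binder is not removable in the kernel today). P2 for
`v ≠ 0` is not derived from P1 in the tree's cyclic `∂`-vocabulary (no divisibility-shift lemma);
it stays primary for Cor. 1.7. Count for the registry: TWO primaries (P1, P2) + THREE flagged
`Ω(W)` shapes; the sixth `Prop` is derived (D2).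

References: Kim 2025 [Kim2025RefinedTNC] Thm. 1.1, Cor. 1.7, §1.4.4; Kim 2026 [Kim2022StructureSelmer]
§1.4.3–1.5.1, Thm. 2.14; `KuriharaNumberInvariants` (cc-typer-1) API.
-/

noncomputable section

open scoped Classical MatrixGroups ModularForm

open CongruenceSubgroup WeierstrassCurve Literature.NumberTheory.EllipticCurves
  Literature.NumberTheory.EllipticCurves.ModularForms

namespace Summit.BirchSwinnertonDyer.Rank1Residual.Additive

variable (W : WeierstrassCurve ℚ) [W.IsElliptic] [W.IsGloballyMinimal] (p : ℕ) [hp : Fact p.Prime]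

/-! ### §0 Elementary: integrality of `[0]⁺_f` from the integral-period hypothesis -/

omit [W.IsElliptic] [W.IsGloballyMinimal] in
/-- If `Ω⁺_f` is an integral period (`0 ≤ ord_p [r]⁺_f` whenever `[r]⁺_f ≠ 0`) and `[0]⁺_f ≠ 0`, then
`p ∤ den [0]⁺_f` (so the tree's mod-`p^k` numbers at level `1` are genuine reductions). [folklore] -/
theorem not_dvd_den_ratPlusSymbol_zero_of_integral {N : ℕ} [NeZero N] {f : CuspForm (Gamma0 N) 2}
    (hint : ∀ r : ℚ, ratPlusSymbol f r ≠ 0 → 0 ≤ padicValRat p (ratPlusSymbol f r))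
    (hne : ratPlusSymbol f 0 ≠ 0) : ¬ p ∣ (ratPlusSymbol f 0).den := by
  apply not_dvd_den_of_norm_ratCast_le_one (p := p)
  have h0 : ((ratPlusSymbol f 0 : ℚ) : ℚ_[p]) ≠ 0 := by exact_mod_cast hne
  rw [Padic.norm_eq_zpow_neg_valuation h0, Padic.valuation_ratCast]
  have hp1 : (1 : ℝ) ≤ (p : ℝ) := by exact_mod_cast hp.out.one_lt.le
  exact zpow_le_one_of_nonpos₀ hp1 (neg_nonpos.mpr (hint 0 hne))

omit [W.IsGloballyMinimal] in
/-- `L(E,1) ≠ 0 ⟹ [0]⁺_f ≠ 0` for the newform `f` of `W` (`L(E,1) = [0]⁺_f · Ω⁺_f`).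
[cite: MazurTateTeitelbaum1986Invent, §I.8 (8.6)] -/
theorem ratPlusSymbol_zero_ne_zero_of_entireLFunction_one_ne_zero
    {N : ℕ} [NeZero N] {f : CuspForm (Gamma0 N) 2} (hf : IsNewformOf W f)
    (hL : W.entireLFunction 1 ≠ 0) : ratPlusSymbol f 0 ≠ 0 := by
  intro h0
  apply hL
  rw [hf.entireLFunction_one_eq, h0]
  simp

omit [W.IsGloballyMinimal] in
/-- `L(E,1) = 0 ⟹ [0]⁺_f = 0` for the newform `f` of `W` (`Ω⁺_f > 0`).
[cite: MazurTateTeitelbaum1986Invent, §I.8 (8.6)] -/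
theorem ratPlusSymbol_zero_eq_zero_of_entireLFunction_one_eq_zero
    {N : ℕ} [NeZero N] {f : CuspForm (Gamma0 N) 2} (hf : IsNewformOf W f)
    (hL : W.entireLFunction 1 = 0) : ratPlusSymbol f 0 = 0 := by
  have hpos : 0 < plusPeriod f := IsNewform0.plusPeriod_pos_holds hf.1 hf.coeffField_eq_bot
  have h1 := hf.entireLFunction_one_eq
  rw [hL] at h1
  have h2 : ((ratPlusSymbol f 0 : ℚ) : ℝ) * plusPeriod f = 0 := by exact_mod_cast h1.symm
  have h3 : ((ratPlusSymbol f 0 : ℚ) : ℝ) = 0 := (mul_eq_zero.mp h2).resolve_right hpos.ne'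
  exact_mod_cast h3

/-! ### §1 (D1) P1 ⟹ Cor. 1.7's inequality for the integral period `Ω⁺_f` (`v = 0`) -/

/-- **(D1) Thm. 1.1 ("BSD") clause (P1) ⟹ `ord_p #Ш(E/ℚ)(p) ≤ ord_p [0]⁺_f`** in analytic rank `0`
with `Ω⁺_f` an integral period: `ord(δ̃) = 0` (`[0]⁺_f ≠ 0`, `p`-integral), `∂^{(0)} = ord_p [0]⁺_f`
(`kuriharaDivIndex_one_eq`), and P1 at `r = 0` gives `∂^{(0)} = ord_p #Ш(p) + ∂^{(∞)}`. This is P2's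
instance `v = 0`. CONDITIONAL on the preprint. [claim: Kim2025RefinedTNC, status: under-review]
[cite: Kim2025RefinedTNC, Thm. 1.1 ("BSD"), Cor. 1.7 (ANNOUNCED, OPEN binder)] [cite: Kim2022StructureSelmer, §1.5.1 (PDF p. 7)] -/
theorem cor17_le_at_integral_of_thm11
    (hK25s : Kim2025.thm11_kimShaLength_of_integralPeriod_OPEN)
    (hp3 : 3 ≤ p) (htower : ∀ n : ℕ, W.HasSurjectiveModNGaloisRep (p ^ n : ℕ))
    (hL : W.entireLFunction 1 ≠ 0) (hfin : Finite W.sha)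
    {N : ℕ} [NeZero N] {f : CuspForm (Gamma0 N) 2} (hf : IsNewformOf W f)
    (hint : ∀ r : ℚ, ratPlusSymbol f r ≠ 0 → 0 ≤ padicValRat p (ratPlusSymbol f r)) :
    (padicValNat p (Nat.card (AddCommGroup.primaryComponent W.sha p)) : ℤ) ≤
      padicValRat p (ratPlusSymbol f 0) := by
  have hne := ratPlusSymbol_zero_ne_zero_of_entireLFunction_one_ne_zero W hf hL
  have hden := not_dvd_den_ratPlusSymbol_zero_of_integral p hint hne
  obtain ⟨d, -, h0⟩ := hK25s W p hp3 htower hfin f hf hint 0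
    (kuriharaVanishingOrder_eq_zero_of_ratPlusSymbol_ne_zero W p f hden hne)
  rw [kuriharaPartial_zero, kuriharaDivIndex_one_eq W p f hden hne] at h0
  have hnat : (padicValRat p (ratPlusSymbol f 0)).toNat =
      padicValNat p (Nat.card (AddCommGroup.primaryComponent W.sha p)) + d := by
    exact_mod_cast h0
  have hcast : ((padicValRat p (ratPlusSymbol f 0)).toNat : ℤ) = padicValRat p (ratPlusSymbol f 0) :=
    Int.toNat_of_nonneg (hint 0 hne)
  omega

/-! ### §2 (D2) P1 ⟹ the unit own-currency `Prop` (so it is not an independent input) -/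

/-- **(D2) Thm. 1.1 ("BSD") clause (P1) ⟹ the unit own-currency clause**: with a unit Kurihara number
at a cyclic level, `∂^{(∞)} = 0` (`kuriharaPartialInfty_eq_zero_of_ne_zero`), hence
`ord_p #Ш(E/ℚ)(p) = ∂^{(0)} = ord_p [0]⁺_f`. CONDITIONAL on the preprint.
[claim: Kim2025RefinedTNC, status: under-review] [cite: Kim2025RefinedTNC, Thm. 1.1 ("BSD"), Cor. 1.7 (ANNOUNCED, OPEN binder)]
[cite: Kim2022StructureSelmer, §1.5.1 (PDF p. 7)] -/
theorem cor17_unit_at_integral_of_thm11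
    (hK25s : Kim2025.thm11_kimShaLength_of_integralPeriod_OPEN)
    (hp3 : 3 ≤ p) (htower : ∀ n : ℕ, W.HasSurjectiveModNGaloisRep (p ^ n : ℕ))
    (hL : W.entireLFunction 1 ≠ 0) (hfin : Finite W.sha)
    {N : ℕ} [NeZero N] {f : CuspForm (Gamma0 N) 2} (hf : IsNewformOf W f)
    (hint : ∀ r : ℚ, ratPlusSymbol f r ≠ 0 → 0 ≤ padicValRat p (ratPlusSymbol f r))
    (n : ℕ) [NeZero n] (hn : Kato.IsKolyvaginProduct W p 1 n)
    (hcyc : ∀ (ℓ : ℕ) [Fact ℓ.Prime], ℓ ∣ n →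
      Nat.card {P : ((WeierstrassCurve.integralModelInt W).map
          (Int.castRingHom (ZMod ℓ))).toAffine.Point // p • P = 0} ≤ p)
    (ψ : (ℓ : ℕ) → (ZMod ℓ)ˣ →* Multiplicative (ZMod (p ^ 1)))
    (hψ : ∀ ℓ ∈ n.primeFactors, Function.Surjective (ψ ℓ))
    (hδ : kuriharaNumber f (p ^ 1) n ψ ≠ 0) :
    (padicValNat p (Nat.card (AddCommGroup.primaryComponent W.sha p)) : ℤ) =
      padicValRat p (ratPlusSymbol f 0) := by
  have hne := ratPlusSymbol_zero_ne_zero_of_entireLFunction_one_ne_zero W hf hL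
  have hden := not_dvd_den_ratPlusSymbol_zero_of_integral p hint hne
  obtain ⟨d, hd, h0⟩ := hK25s W p hp3 htower hfin f hf hint 0
    (kuriharaVanishingOrder_eq_zero_of_ratPlusSymbol_ne_zero W p f hden hne)
  have hinf : kuriharaPartialInfty W p f = 0 :=
    kuriharaPartialInfty_eq_zero_of_ne_zero W p f ⟨hn, hcyc⟩ ψ hψ hδ
  have hd0 : d = 0 := by
    rw [hinf] at hd
    exact_mod_cast hd.symm
  rw [kuriharaPartial_zero, kuriharaDivIndex_one_eq W p f hden hne] at h0
  have hnat : (padicValRat p (ratPlusSymbol f 0)).toNat =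
      padicValNat p (Nat.card (AddCommGroup.primaryComponent W.sha p)) + d := by
    exact_mod_cast h0
  have hcast : ((padicValRat p (ratPlusSymbol f 0)).toNat : ℤ) = padicValRat p (ratPlusSymbol f 0) :=
    Int.toNat_of_nonneg (hint 0 hne)
  omega

/-- **(D2, def level) P1 ⟹ the sixth `Prop` literally**:
`Kim2025.thm11_kimShaLength_of_integralPeriod_OPEN → Kim2025.cor17_rankZero_padicValRat_sha_eq_of_kuriharaNumber_ne_zero_of_integralPeriod_OPEN`.
So the registry may count the unit own-currency `Prop` as DERIVED, not as an independent input.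
[claim: Kim2025RefinedTNC, status: under-review] [cite: Kim2025RefinedTNC, Thm. 1.1 ("BSD"), Cor. 1.7 (ANNOUNCED, OPEN binder)] -/
theorem cor17_unit_OPEN_of_thm11_OPEN (hK25s : Kim2025.thm11_kimShaLength_of_integralPeriod_OPEN) :
    Kim2025.cor17_rankZero_padicValRat_sha_eq_of_kuriharaNumber_ne_zero_of_integralPeriod_OPEN := by
  intro V _ _ q _ hq3 htower hL hfin N _ f hf hint n _ hn hcyc ψ hψ hδ
  exact cor17_unit_at_integral_of_thm11 V q hK25s hq3 htower hL hfin hf hint n hn hcyc ψ hψ hδ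

/-! ### §3 (D3) P1 ⟹ the rank-one own-currency clause (O7 ∩ X4@3) -/

omit [W.IsElliptic] hp in
/-- At the level `n = 1`, `[0]⁺_f = 0` makes every Kurihara number vanish, so the divisibility index
is `⊤` ("`δ̃_1 = 0` imposes no constraint", Kim Def. 2.13). [cite: Kim2022StructureSelmer, §1.4.3 (PDF p. 7), Def. 2.13 (PDF p. 14)] -/
theorem kuriharaDivIndex_one_eq_top_of_ratPlusSymbol_zero_eq_zero
    {N : ℕ} {f : CuspForm (Gamma0 N) 2} (h0 : ratPlusSymbol f 0 = 0) :
    kuriharaDivIndex W p f 1 = ⊤ := by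
  refine ENat.eq_top_iff_forall_ge.mpr fun m => le_kuriharaDivIndex_of_divisibleAt W p f ?_
  rw [kuriharaDivisibleAt_one_iff]
  intro k _
  rw [h0, ratModP_zero]

omit [W.IsElliptic] hp in
/-- **`ord(δ̃) = 1` from `[0]⁺_f = 0` and a unit Kurihara number at a PRIME cyclic Kolyvagin level**
(`δ̃_1 = 0`, so no level with `ν = 0` counts; `δ̃_ℓ ≠ 0`, `ν(ℓ) = 1`). [cite: Kim2022StructureSelmer, §1.4.4 (PDF p. 7)] -/
theorem kuriharaVanishingOrder_eq_one_of_prime_unit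
    {N : ℕ} {f : CuspForm (Gamma0 N) 2} (h0 : ratPlusSymbol f 0 = 0)
    (ℓ : ℕ) [hℓ : Fact ℓ.Prime] (hℓK : Kato.IsKolyvaginPrime W p 1 ℓ)
    (hcyc : Nat.card {P : ((WeierstrassCurve.integralModelInt W).map
        (Int.castRingHom (ZMod ℓ))).toAffine.Point // p • P = 0} ≤ p)
    (ψ : (ℓ' : ℕ) → (ZMod ℓ')ˣ →* Multiplicative (ZMod (p ^ 1)))
    (hψ : Function.Surjective (ψ ℓ)) (hδ : kuriharaNumber f (p ^ 1) ℓ ψ ≠ 0) :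
    kuriharaVanishingOrder W p f = 1 := by
  haveI : NeZero ℓ := ⟨hℓ.out.ne_zero⟩
  have hprod : Kato.IsKolyvaginProduct W p 1 ℓ := hℓK.isKolyvaginProduct
  have hψ' : ∀ ℓ' ∈ ℓ.primeFactors, Function.Surjective (ψ ℓ') := by
    intro ℓ' hmem
    rw [hℓ.out.primeFactors, Finset.mem_singleton] at hmem
    subst hmem
    exact hψ
  have hcyc' : IsCyclicKolyvaginLevel W p ℓ := by
    refine ⟨hprod, fun ℓ' _ hdvd => ?_⟩
    have hℓ' : ℓ' = ℓ := (Nat.prime_dvd_prime_iff_eq (Fact.out : ℓ'.Prime) hℓ.out).mp hdvd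
    subst hℓ'
    exact hcyc
  have hidx : kuriharaDivIndex W p f ℓ = 0 := kuriharaDivIndex_eq_zero_of_ne_zero W p f hprod ψ hψ' hδ
  have hcard : ℓ.primeFactors.card = 1 := by rw [hℓ.out.primeFactors, Finset.card_singleton]
  refine le_antisymm ?_ ?_
  · -- `≤ 1`: the level `ℓ` has a finite index and one prime factor
    refine iInf_le_of_le ℓ (iInf_le_of_le hcyc' (iInf_le_of_le ?_ ?_))
    · rw [hidx]; exact ENat.coe_lt_top 0
    · rw [hcard]; exact le_rfl
  · -- `≥ 1`: a level with finite index is not `1` (index `⊤` there), hence has a prime factor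
    refine le_iInf fun n => le_iInf fun hn => le_iInf fun hlt => ?_
    have hn1 : n ≠ 1 := by
      rintro rfl
      rw [kuriharaDivIndex_one_eq_top_of_ratPlusSymbol_zero_eq_zero W p h0] at hlt
      exact lt_irrefl _ hlt
    have hn0 : n ≠ 0 := hn.1.ne_zero
    have hne : n.primeFactors.Nonempty := by
      rw [Finset.nonempty_iff_ne_empty, Ne, Nat.primeFactors_eq_empty]
      omega
    exact_mod_cast Finset.card_pos.mpr hne

/-- **(D3) Thm. 1.1 ("BSD") clause (P1) ⟹ the rank-one own-currency clause**: `p ≥ 3`, tower,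
`L(E,1) = 0`, `Ш(E/ℚ)` finite, newform `f` with `Ω⁺_f` an integral period, and a unit Kurihara number
at a PRIME cyclic Kolyvagin level `ℓ` ⟹ `ord_p #Ш(E/ℚ)(p) = 0` (P1 at `r = ord(δ̃) = 1`:
`∂^{(1)} = ord_p #Ш(p) + ∂^{(∞)}` and `∂^{(1)} ≤ index(ℓ) = 0`). The `Ω(W)`-shaped rank-one `Prop` of
the Literature file carries a Manin datum instead and stays flagged. CONDITIONAL on the preprint.
[claim: Kim2025RefinedTNC, status: under-review] [cite: Kim2025RefinedTNC, Thm. 1.1 (Str)/("BSD") (ANNOUNCED, OPEN binder)]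
[cite: Kim2022StructureSelmer, §1.4.4, §1.5.1 (PDF p. 7)] -/
theorem rankOne_sha_val_eq_zero_of_thm11
    (hK25s : Kim2025.thm11_kimShaLength_of_integralPeriod_OPEN)
    (hp3 : 3 ≤ p) (htower : ∀ n : ℕ, W.HasSurjectiveModNGaloisRep (p ^ n : ℕ))
    (hL : W.entireLFunction 1 = 0) (hfin : Finite W.sha)
    {N : ℕ} [NeZero N] {f : CuspForm (Gamma0 N) 2} (hf : IsNewformOf W f)
    (hint : ∀ r : ℚ, ratPlusSymbol f r ≠ 0 → 0 ≤ padicValRat p (ratPlusSymbol f r))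
    (ℓ : ℕ) [hℓ : Fact ℓ.Prime] (hℓK : Kato.IsKolyvaginPrime W p 1 ℓ)
    (hcyc : Nat.card {P : ((WeierstrassCurve.integralModelInt W).map
        (Int.castRingHom (ZMod ℓ))).toAffine.Point // p • P = 0} ≤ p)
    (ψ : (ℓ' : ℕ) → (ZMod ℓ')ˣ →* Multiplicative (ZMod (p ^ 1)))
    (hψ : Function.Surjective (ψ ℓ)) (hδ : kuriharaNumber f (p ^ 1) ℓ ψ ≠ 0) :
    padicValNat p (Nat.card (AddCommGroup.primaryComponent W.sha p)) = 0 := by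
  haveI : NeZero ℓ := ⟨hℓ.out.ne_zero⟩
  have h0 := ratPlusSymbol_zero_eq_zero_of_entireLFunction_one_eq_zero W hf hL
  have hord := kuriharaVanishingOrder_eq_one_of_prime_unit W p h0 ℓ hℓK hcyc ψ hψ hδ
  obtain ⟨d, -, h1⟩ := hK25s W p hp3 htower hfin f hf hint 1 hord
  -- `∂^{(1)} ≤ index(ℓ) = 0`
  have hψ' : ∀ ℓ' ∈ ℓ.primeFactors, Function.Surjective (ψ ℓ') := by
    intro ℓ' hmem
    rw [hℓ.out.primeFactors, Finset.mem_singleton] at hmem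
    subst hmem
    exact hψ
  have hcyc' : IsCyclicKolyvaginLevel W p ℓ := by
    refine ⟨hℓK.isKolyvaginProduct, fun ℓ' _ hdvd => ?_⟩
    have hℓ' : ℓ' = ℓ := (Nat.prime_dvd_prime_iff_eq (Fact.out : ℓ'.Prime) hℓ.out).mp hdvd
    subst hℓ'
    exact hcyc
  have hcard : ℓ.primeFactors.card = 1 := by rw [hℓ.out.primeFactors, Finset.card_singleton]
  have hle : kuriharaPartial W p f 1 ≤ 0 := by
    have := kuriharaPartial_le W p f hcyc' hcard
    rwa [kuriharaDivIndex_eq_zero_of_ne_zero W p f hℓK.isKolyvaginProduct ψ hψ' hδ] at this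
  rw [h1] at hle
  have h2 : padicValNat p (Nat.card (AddCommGroup.primaryComponent W.sha p)) + d ≤ 0 := by
    exact_mod_cast hle
  omega

/-! ### §4 (D4) APPEND: P1 ⟹ the LEVEL-`k` clause (planner r1's R1-6, `cells/n1011/route1/R16_sketch.lean`;
lead R4-5) — a DERIVED member of the family, NOT a new primary and NOT a new `_OPEN` def

r1 proposed an own-currency OPEN member "one non-zero `δ̃_n mod p^k` at a cyclic `n ∈ 𝒩_k` ⟹
`ord_p [0]⁺_f − (k − 1) ≤ ord_p #Ш(E/ℚ)(p)`" (the TAM-DEFECT certificate shape, Kim–Pollack App. §8.1.2: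
20787.e1 at `3` read at level `𝒩₂`). It is a FORMAL consequence of P1 and the tree's `∂`-API: a non-zero
`δ̃_n mod p^k` gives `kuriharaDivIndex n ≤ k − 1`, hence `∂^{(∞)} ≤ ∂^{(ν(n))} ≤ k − 1`, and P1 at `r = 0`
gives `ord_p #Ш(p) = ord_p [0]⁺_f − ∂^{(∞)}` (the index bound is n1011-p17's
`kuriharaDivIndex_le_of_kuriharaNumber_ne_zero`, p251071; a private copy is used here). So no new `Prop` is filed; the registry count of
`X4KimLargeImagePrimary` (2 primaries + 3 flagged + derived) is unchanged. -/

omit [W.IsElliptic] hp in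
/-- **A non-zero mod-`p^k` Kurihara number bounds the divisibility index: `kuriharaDivIndex n ≤ k − 1`**
(`δ̃_n ∉ p^k ℤ_p/I_nℤ_p`; Kim Def. 2.13). Local copy of n1011-p17's
`kuriharaDivIndex_le_of_kuriharaNumber_ne_zero` (`X4RankOneKimPartialShape.lean`, p251071), kept
private to avoid importing the rank-one chain here. [cite: Kim2022StructureSelmer, §1.5.1 (PDF p. 7), Def. 2.13 (PDF p. 14)] -/
private theorem divIndex_le_pred_of_kuriharaNumber_ne_zero {N : ℕ} {f : CuspForm (Gamma0 N) 2} {k n : ℕ}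
    [NeZero n] (hn : Kato.IsKolyvaginProduct W p k n)
    (ψ : (ℓ : ℕ) → (ZMod ℓ)ˣ →* Multiplicative (ZMod (p ^ k)))
    (hψ : ∀ ℓ ∈ n.primeFactors, Function.Surjective (ψ ℓ)) (hδ : kuriharaNumber f (p ^ k) n ψ ≠ 0) :
    kuriharaDivIndex W p f n ≤ ((k - 1 : ℕ) : ℕ∞) := by
  rw [kuriharaDivIndex_def]
  refine iSup₂_le fun j hj => ?_
  by_contra hlt
  have hkj : k ≤ j := by
    have h' : ¬ j ≤ k - 1 := fun h => hlt (by exact_mod_cast h)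
    omega
  exact hδ (hj k hkj hn ψ hψ)

/-- **(D4) Thm. 1.1 ("BSD") clause (P1) ⟹ the level-`k` LOWER bound** (r1's R1-6 shape, own currency):
`p ≥ 3`, tower, `L(E,1) ≠ 0`, `Ш(E/ℚ)` finite, newform `f` with `Ω⁺_f` an integral period, `k ≥ 1`, a
cyclic level `n ∈ 𝒩_k` (`#Ẽ(𝔽_ℓ)[p] ≤ p` for `ℓ ∣ n`), surjective `ψ_ℓ : (ℤ/ℓ)ˣ ↠ ℤ/p^k`, and
`kuriharaNumber f (p^k) n ψ ≠ 0` ⟹ `ord_p [0]⁺_f − (k − 1) ≤ ord_p #Ш(E/ℚ)(p)`. At `k = 1` this is the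
`≥` half of the unit clause (D2). CONDITIONAL on the preprint (flag `Kim2025-preprint`).
[claim: Kim2025RefinedTNC, status: under-review] [cite: Kim2025RefinedTNC, Thm. 1.1 ("BSD"), Cor. 1.7, §8.1.2 (ANNOUNCED, OPEN binder)]
[cite: Kim2022StructureSelmer, §1.5.1 (PDF p. 7), Def. 2.13 (PDF p. 14)] -/
theorem cor17_levelK_le_of_thm11
    (hK25s : Kim2025.thm11_kimShaLength_of_integralPeriod_OPEN)
    (hp3 : 3 ≤ p) (htower : ∀ n : ℕ, W.HasSurjectiveModNGaloisRep (p ^ n : ℕ))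
    (hL : W.entireLFunction 1 ≠ 0) (hfin : Finite W.sha)
    {N : ℕ} [NeZero N] {f : CuspForm (Gamma0 N) 2} (hf : IsNewformOf W f)
    (hint : ∀ r : ℚ, ratPlusSymbol f r ≠ 0 → 0 ≤ padicValRat p (ratPlusSymbol f r))
    (k n : ℕ) [NeZero n] (hk : 1 ≤ k) (hn : Kato.IsKolyvaginProduct W p k n)
    (hcyc : ∀ (ℓ : ℕ) [Fact ℓ.Prime], ℓ ∣ n →
      Nat.card {P : ((WeierstrassCurve.integralModelInt W).map
          (Int.castRingHom (ZMod ℓ))).toAffine.Point // p • P = 0} ≤ p)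
    (ψ : (ℓ : ℕ) → (ZMod ℓ)ˣ →* Multiplicative (ZMod (p ^ k)))
    (hψ : ∀ ℓ ∈ n.primeFactors, Function.Surjective (ψ ℓ))
    (hδ : kuriharaNumber f (p ^ k) n ψ ≠ 0) :
    padicValRat p (ratPlusSymbol f 0) - ((k - 1 : ℕ) : ℤ) ≤
      (padicValNat p (Nat.card (AddCommGroup.primaryComponent W.sha p)) : ℤ) := by
  have hne := ratPlusSymbol_zero_ne_zero_of_entireLFunction_one_ne_zero W hf hL
  have hden := not_dvd_den_ratPlusSymbol_zero_of_integral p hint hne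
  obtain ⟨d, hd, h0⟩ := hK25s W p hp3 htower hfin f hf hint 0
    (kuriharaVanishingOrder_eq_zero_of_ratPlusSymbol_ne_zero W p f hden hne)
  rw [kuriharaPartial_zero, kuriharaDivIndex_one_eq W p f hden hne] at h0
  have hnat : (padicValRat p (ratPlusSymbol f 0)).toNat =
      padicValNat p (Nat.card (AddCommGroup.primaryComponent W.sha p)) + d := by
    exact_mod_cast h0
  have hcast : ((padicValRat p (ratPlusSymbol f 0)).toNat : ℤ) = padicValRat p (ratPlusSymbol f 0) :=
    Int.toNat_of_nonneg (hint 0 hne)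
  -- `∂^{(∞)} = d ≤ k − 1` from the non-zero level-`k` number
  have hcyc1 : IsCyclicKolyvaginLevel W p n := ⟨hn.mono hk, hcyc⟩
  have hdle : (d : ℕ∞) ≤ ((k - 1 : ℕ) : ℕ∞) := by
    rw [← hd]
    exact (kuriharaPartialInfty_le W p f _).trans
      ((kuriharaPartial_le W p f hcyc1 rfl).trans
        (divIndex_le_pred_of_kuriharaNumber_ne_zero W p hn ψ hψ hδ))
  have hdk : d ≤ k - 1 := by exact_mod_cast hdle
  omega

end Summit.BirchSwinnertonDyer.Rank1Residual.Additive

end
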